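import Summits.HubbardSuperconductivity.HubbardSuperconductivity.Theorems.AnisotropyChordTransferCompressibility

/-!
# Route `AnisotropyChord` / H0 rotor rung, route (1): PROPOSITION N, part 2 of 2 — the RESPONSE form of the transfer step and the
# `k = 0` (symmetric) version (VERBATIM port of the theory seat's `PartH.lean` v3, sha16 ae97bda14caca3ee, from «Response form of the
# transfer step» to the end; theory seat `hubbard-h0-rotor-theory-1` g12, memo ROTOR-THEORY-12 §184; prover seat `hubbard-h0-rotor-p1` g14)

* `RaisedResponseBound` (HYPOTHESIS Ξ) and `one_sub_fidelity_sq_le` / `raised_one_sub_fidelity_sq_le`: `(1 − F)² ≤ Ξ·η`;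
* `SymGapAtLeast`, `PhononSaturationBelowSym` (R₀), `feynman_scale_lower`, `symGapAtLeast_of_saturationSym`,
  `symmetricSectorGap_of_symGapAtLeast`, and the END-TO-END
  **`symmetricSectorGap_of_compressibility_saturation`**: K ∧ F ∧ R₀ (uniform on `|j| ≤ k`, eventually in `L`) ⇒ the tree's (H2)
  `SymmetricSectorGap Δ (c_s √(f₀/κ)) k`.
-/

set_option linter.dupNamespace false
set_option autoImplicit false

noncomputable section

open Finset Filter Topology
open Literature.MathematicalPhysics.QuantumLattice Literature.Probability.LatticeModels
open Summit.HubbardSuperconductivity.HubbardSuperconductivity.Theorems.AnisotropyChord.InsertionEntropy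
open Summit.HubbardSuperconductivity.HubbardSuperconductivity.Theorems.AnisotropyChord.Tower

namespace Summit.HubbardSuperconductivity.HubbardSuperconductivity.Theorems.AnisotropyChord.Transfer

variable {L : ℕ} [NeZero L]

/-! ## Response form of the transfer step: `(1 − F)² ≤ Ξ·η` (memo §184(f))

T needs per link only `F_j → 1`.  TEMPLE gives `1 − F ≤ η/γ` (gap form, the tree's (H2)); the RESPONSE form below gives
`(1 − F)² ≤ Ξ η` where `Ξ` bounds the Legendre functional of the tower-removed raised vector — a `k = 0` order-parameter
RESPONSE with the tower pole removed (`Ξ ≤ 1/γ` always, so this hypothesis is implied by, and strictly weaker than, a gap). -/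

/-- the normalised raised vector `Φ̂ = S⁺a / ‖S⁺a‖`. [folklore] -/
def raisedUnit (a : TensorIndex (TorusSite 2 L) 2 → ℝ) : TensorIndex (TorusSite 2 L) 2 → ℝ :=
  fun σ => raiseSum a σ / Real.sqrt (raiseNormSq a)

/-- **HYPOTHESIS Ξ — tower-removed `k = 0` order-parameter response of the link `M → M + 1`, Legendre form:**
`2⟨φ, Φ̂ − ⟨b,Φ̂⟩b⟩ − ⟨φ,(H − E(M+1))φ⟩ ≤ Ξ` for every real amplitude `φ` of the sector `M + 1`
(`a`, `b` the Perron amplitudes of the sectors `M`, `M + 1`; the supremum over `φ` is `⟨w,(H − E)⁻¹w⟩`, `w = Φ̂ − ⟨b,Φ̂⟩b`).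
[conjecture: theory seat hubbard-h0-rotor-theory-1, cycle 12 — response form of (H2); implied by (H2-weak′)] -/
def RaisedResponseBound (Δ M Ξ : ℝ) : Prop :=
  ∀ a b φ : TensorIndex (TorusSite 2 L) 2 → ℝ, IsPerronSectorGroundAmplitude L Δ M a →
    IsPerronSectorGroundAmplitude L Δ (M + 1) b → cplx L φ ∈ spinZSector (Λ := TorusSite 2 L) 1 (M + 1) →
      2 * (∑ σ, φ σ * (raisedUnit a σ - (∑ τ, b τ * raisedUnit a τ) * b σ))
        - (energyQ L Δ φ - sectorE L Δ (M + 1) * ∑ σ, φ σ ^ 2) ≤ Ξ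

/-- **response-form Temple (abstract):** for a unit real amplitude `Φ` of the sector `M'` with fidelity `F = ⟨b, Φ⟩²` against the
Perron amplitude `b` and excess `η = ⟨Φ, HΦ⟩ − E(M')`, the Legendre bound `Ξ` for `w = Φ − ⟨b,Φ⟩b` gives `(1 − F)² ≤ Ξ η`.
[conjecture: theory seat hubbard-h0-rotor-theory-1, cycle 12 — PROVED here] -/
theorem one_sub_fidelity_sq_le {Δ M' Ξ : ℝ} {b Φ : TensorIndex (TorusSite 2 L) 2 → ℝ}
    (hb : IsPerronSectorGroundAmplitude L Δ M' b)
    (hΦ : cplx L Φ ∈ spinZSector (Λ := TorusSite 2 L) 1 M') (hΦ1 : ∑ σ, Φ σ ^ 2 = 1)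
    (hΞ : ∀ φ : TensorIndex (TorusSite 2 L) 2 → ℝ, cplx L φ ∈ spinZSector (Λ := TorusSite 2 L) 1 M' →
      2 * (∑ σ, φ σ * (Φ σ - (∑ τ, b τ * Φ τ) * b σ)) - (energyQ L Δ φ - sectorE L Δ M' * ∑ σ, φ σ ^ 2) ≤ Ξ) :
    (1 - (∑ σ, b σ * Φ σ) ^ 2) ^ 2 ≤ Ξ * (energyQ L Δ Φ - sectorE L Δ M') := by
  set c := ∑ τ, b τ * Φ τ with hc
  set p := 1 - c ^ 2 with hp
  set η := energyQ L Δ Φ - sectorE L Δ M' with hη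
  -- membership of the ray t • Φ
  have hmem : ∀ t : ℝ, cplx L (t • Φ) ∈ spinZSector (Λ := TorusSite 2 L) 1 M' := by
    intro t
    have e : cplx L (t • Φ) = (t : ℂ) • cplx L Φ := by
      funext σ; simp [cplx, Pi.smul_apply, smul_eq_mul]
    rw [e]; exact Submodule.smul_mem _ _ hΦ
  have ray : ∀ t : ℝ, 2 * t * p - t ^ 2 * η ≤ Ξ := by
    intro t
    have h := hΞ (t • Φ) (hmem t)
    have e1 : (∑ σ, (t • Φ) σ * (Φ σ - c * b σ)) = t * p := by
      simp only [Pi.smul_apply, smul_eq_mul]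
      have : (∑ σ, t * Φ σ * (Φ σ - c * b σ)) = t * (∑ σ, Φ σ ^ 2) - t * c * (∑ σ, b σ * Φ σ) := by
        rw [Finset.mul_sum, Finset.mul_sum, ← Finset.sum_sub_distrib]
        refine Finset.sum_congr rfl fun σ _ => by ring
      rw [this, hΦ1, ← hc, hp]; ring
    have e2 : (∑ σ, (t • Φ) σ ^ 2) = t ^ 2 := by
      simp only [Pi.smul_apply, smul_eq_mul]
      have : (∑ σ, (t * Φ σ) ^ 2) = t ^ 2 * ∑ σ, Φ σ ^ 2 := by
        rw [Finset.mul_sum]; refine Finset.sum_congr rfl fun σ _ => by ring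
      rw [this, hΦ1, mul_one]
    have e3 : energyQ L Δ (t • Φ) = t ^ 2 * energyQ L Δ Φ := energyQ_smul Δ t Φ
    rw [e1, e2, e3] at h
    have e4 : t ^ 2 * energyQ L Δ Φ - sectorE L Δ M' * t ^ 2 = t ^ 2 * η := by rw [hη]; ring
    rw [e4] at h
    linarith
  -- p ≥ 0 (Cauchy–Schwarz) and η ≥ 0 (variational floor)
  have hp0 : 0 ≤ p := by
    have h := Finset.sum_mul_sq_le_sq_mul_sq (Finset.univ) b Φ
    rw [hb.unit, hΦ1] at h
    rw [hp]; nlinarith [h]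
  have hη0 : 0 ≤ η := by
    rw [hη]
    have hv := sectorE_mul_le_energyQ Δ M' Φ (fun σ hσ => zerosCard_of_mem_spinZSector hΦ σ hσ)
    rw [hΦ1, mul_one] at hv; linarith
  have hΞ0 : 0 ≤ Ξ := by simpa using ray 0
  by_cases hηpos : 0 < η
  · have h := ray (p / η)
    have e : 2 * (p / η) * p - (p / η) ^ 2 * η = p ^ 2 / η := by field_simp; ring
    rw [e, div_le_iff₀ hηpos] at h
    linarith
  · have hηz : η = 0 := le_antisymm (not_lt.1 hηpos) hη0
    have hpz : p = 0 := by
      by_contra hne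
      have hppos : 0 < p := lt_of_le_of_ne hp0 (Ne.symm hne)
      have h := ray ((Ξ + 1) / (2 * p))
      rw [hηz] at h
      have e : 2 * ((Ξ + 1) / (2 * p)) * p = Ξ + 1 := by field_simp
      rw [e] at h; linarith
    rw [hpz, hηz]; simp

/-- **response-form transfer bound for the raised Perron vector:** under HYPOTHESIS Ξ, `(1 − F)² ≤ Ξ·η` with
`F = ⟨b, Φ̂⟩²`, `η = ⟨Φ̂, HΦ̂⟩ − E(M+1)`, `Φ̂ = S⁺a/‖S⁺a‖` — provided `Φ̂` is a unit vector of the sector `M + 1`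
(true for a Perron `a` of a non-top sector; taken as hypotheses here). [conjecture: theory seat, cycle 12 — PROVED here] -/
theorem raised_one_sub_fidelity_sq_le {Δ M Ξ : ℝ} {a b : TensorIndex (TorusSite 2 L) 2 → ℝ}
    (hΞ : RaisedResponseBound (L := L) Δ M Ξ) (ha : IsPerronSectorGroundAmplitude L Δ M a)
    (hb : IsPerronSectorGroundAmplitude L Δ (M + 1) b)
    (hmem : cplx L (raisedUnit a) ∈ spinZSector (Λ := TorusSite 2 L) 1 (M + 1))
    (hunit : ∑ σ, raisedUnit a σ ^ 2 = 1) :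
    (1 - (∑ σ, b σ * raisedUnit a σ) ^ 2) ^ 2
      ≤ Ξ * (energyQ L Δ (raisedUnit a) - sectorE L Δ (M + 1)) :=
  one_sub_fidelity_sq_le hb hmem hunit (fun φ hφ => hΞ a b φ ha hb hφ)

/-! ## The `k = 0` (translation-invariant) variant actually consumed by T

T's Temple step only sees translation-invariant test amplitudes, so the saturation hypothesis may be restricted to them
(R₀: «the `k = 0` gap above `E(M)` — two phonons — is at least `c_s` times the one-phonon Feynman energy at `k₁`»; weaker than R). -/

/-- **`k = 0` sector gap `≥ g` (the tree's Temple form, one sector):** as `SectorGapAtLeast` but only for translation-invariant `φ`. [folklore] -/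
def SymGapAtLeast (Δ M g : ℝ) : Prop :=
  ∀ a φ : TensorIndex (TorusSite 2 L) 2 → ℝ, IsPerronSectorGroundAmplitude L Δ M a →
    cplx L φ ∈ spinZSector (Λ := TorusSite 2 L) 1 M → (∀ v σ, φ (shiftCfg L v σ) = φ σ) → ∑ σ, φ σ ^ 2 = 1 →
      g * (1 - (∑ σ, a σ * φ σ) ^ 2) ≤ energyQ L Δ φ - sectorE L Δ M

/-- **HYPOTHESIS R₀ — Feynman saturation from below at `k = 0`:** the `k = 0` gap above `E(M)` is at least
`c_s ⟨c a,(H − E) c a⟩/‖c a‖²`. [conjecture: theory seat hubbard-h0-rotor-theory-1, cycle 12 — residual of (H2), k = 0 form; OPEN] -/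
def PhononSaturationBelowSym (Δ M cs : ℝ) : Prop :=
  ∀ a : TensorIndex (TorusSite 2 L) 2 → ℝ, IsPerronSectorGroundAmplitude L Δ M a →
    0 < strucC L a ∧
    ∀ φ : TensorIndex (TorusSite 2 L) 2 → ℝ, cplx L φ ∈ spinZSector (Λ := TorusSite 2 L) 1 M →
      (∀ v σ, φ (shiftCfg L v σ) = φ σ) → ∑ σ, φ σ ^ 2 = 1 →
        cs * (fsumC L Δ M a / strucC L a) * (1 - (∑ σ, a σ * φ σ) ^ 2) ≤ energyQ L Δ φ - sectorE L Δ M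

/-- the Feynman scale from K′ and F: `√(f₀/κ)/L ≤ ⟨c a,(H − E) c a⟩/‖c a‖²`. [folklore] -/
theorem feynman_scale_lower {Δ M κ f₀ : ℝ} (hκ : 0 < κ)
    (hK : SingleModeResponseBound L Δ M κ) (hFl : FsumLower L Δ M f₀)
    {a : TensorIndex (TorusSite 2 L) 2 → ℝ} (ha : IsPerronSectorGroundAmplitude L Δ M a) (hSpos : 0 < strucC L a) :
    Real.sqrt (f₀ / κ) / (L : ℝ) ≤ fsumC L Δ M a / strucC L a := by
  set S := strucC L a with hS
  set F := fsumC L Δ M a with hF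
  set V : ℝ := (Fintype.card (TorusSite 2 L) : ℝ) with hV
  have hLpos : 0 < (L : ℝ) := by exact_mod_cast Nat.pos_of_ne_zero (NeZero.ne L)
  have hVpos : 0 < V := by rw [hV]; exact_mod_cast Fintype.card_pos
  have hK' : S ^ 2 ≤ κ * V * F := hK a ha
  have hFl' : f₀ * V / (L : ℝ) ^ 2 ≤ F := hFl a ha
  have hFpos : 0 < F := by
    by_contra h
    have hFle : F ≤ 0 := not_lt.1 h
    have : S ^ 2 ≤ 0 := le_trans hK' (by nlinarith [mul_pos hκ hVpos])
    nlinarith [hSpos]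
  have hq : f₀ / κ / (L : ℝ) ^ 2 ≤ (F / S) ^ 2 := by
    have h1 : (F / S) ^ 2 = F * F / S ^ 2 := by rw [div_pow]; ring
    have h2 : F / (κ * V) ≤ F * F / S ^ 2 := by
      rw [div_le_div_iff₀ (mul_pos hκ hVpos) (by positivity)]
      nlinarith [hK', hFpos.le]
    have h3 : f₀ / κ / (L : ℝ) ^ 2 ≤ F / (κ * V) := by
      rw [div_div, div_le_div_iff₀ (by positivity) (mul_pos hκ hVpos)]
      have := mul_le_mul_of_nonneg_left hFl' (le_of_lt (mul_pos hκ hVpos))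
      have e : κ * V * (f₀ * V / (L : ℝ) ^ 2) = f₀ * (κ * V) * V / (L : ℝ) ^ 2 := by ring
      rw [e, div_le_iff₀ (by positivity)] at this
      nlinarith [this]
    rw [h1]; exact le_trans h3 h2
  have hFS : 0 ≤ F / S := le_of_lt (div_pos hFpos hSpos)
  have e : Real.sqrt (f₀ / κ) / (L : ℝ) = Real.sqrt (f₀ / κ / (L : ℝ) ^ 2) := by
    rw [Real.sqrt_div' (f₀ / κ) (pow_nonneg hLpos.le 2), Real.sqrt_sq hLpos.le]
  rw [e]
  calc Real.sqrt (f₀ / κ / (L : ℝ) ^ 2) ≤ Real.sqrt ((F / S) ^ 2) := Real.sqrt_le_sqrt hq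
    _ = F / S := Real.sqrt_sq hFS

/-- **PROPOSITION N₀ (the form T consumes):** K′ ∧ F ∧ R₀ give the `k = 0` gap `≥ c_s √(f₀/κ)/L`.
[conjecture: theory seat hubbard-h0-rotor-theory-1, cycle 12 — PROVED here] -/
theorem symGapAtLeast_of_saturationSym {Δ M κ f₀ cs : ℝ} (hκ : 0 < κ) (hcs : 0 ≤ cs)
    (hK : SingleModeResponseBound L Δ M κ) (hFl : FsumLower L Δ M f₀) (hR : PhononSaturationBelowSym (L := L) Δ M cs) :
    SymGapAtLeast (L := L) Δ M (cs * Real.sqrt (f₀ / κ) / (L : ℝ)) := by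
  intro a φ ha hφ hsh hφ1
  obtain ⟨hSpos, hRφ⟩ := hR a ha
  have hgap := hRφ φ hφ hsh hφ1
  have hroot := feynman_scale_lower hκ hK hFl ha hSpos
  have hov : (∑ σ, a σ * φ σ) ^ 2 ≤ 1 := by
    have h := Finset.sum_mul_sq_le_sq_mul_sq (Finset.univ) a φ
    rw [ha.unit, hφ1] at h; simpa using h
  have hfac : 0 ≤ 1 - (∑ σ, a σ * φ σ) ^ 2 := by linarith
  calc cs * Real.sqrt (f₀ / κ) / (L : ℝ) * (1 - (∑ σ, a σ * φ σ) ^ 2)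
      = cs * (Real.sqrt (f₀ / κ) / (L : ℝ)) * (1 - (∑ σ, a σ * φ σ) ^ 2) := by ring
    _ ≤ cs * (fsumC L Δ M a / strucC L a) * (1 - (∑ σ, a σ * φ σ) ^ 2) := by
        apply mul_le_mul_of_nonneg_right _ hfac
        exact mul_le_mul_of_nonneg_left hroot hcs
    _ ≤ energyQ L Δ φ - sectorE L Δ M := hgap

/-- **… and eventually-in-`L` families of them give the tree's (H2) verbatim.** [folklore] -/
theorem symmetricSectorGap_of_symGapAtLeast {Δ c₁ : ℝ} {k : ℕ}
    (h : ∀ᶠ L : ℕ in atTop, ∀ [NeZero L], ∀ j : ℤ, |j| ≤ (k : ℤ) → SymGapAtLeast (L := L) Δ (j : ℝ) (c₁ / (L : ℝ))) :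
    SymmetricSectorGap Δ c₁ k := by
  unfold SymmetricSectorGap
  filter_upwards [h] with L hL
  intro _ j hj a φ ha hφ hsh hφ1
  exact hL j hj a φ ha hφ hsh hφ1

/-- **ARCHITECTURE (A′), the (H2) end:** compressibility K (hence K′), f-sum F and `k = 0` Feynman saturation R₀ with UNIFORM constants
on the sectors `|j| ≤ k`, eventually in `L`, give the tree's (H2) with `c₁ = c_s √(f₀/κ)`. [conjecture: theory seat, cycle 12 — PROVED here] -/
theorem symmetricSectorGap_of_compressibility_saturation {Δ κ f₀ cs : ℝ} {k : ℕ} (hκ : 0 < κ) (hcs : 0 ≤ cs)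
    (h : ∀ᶠ L : ℕ in atTop, ∀ [NeZero L], ∀ j : ℤ, |j| ≤ (k : ℤ) →
      DensityResponseBound L Δ (j : ℝ) κ ∧ FsumLower L Δ (j : ℝ) f₀ ∧ PhononSaturationBelowSym (L := L) Δ (j : ℝ) cs) :
    SymmetricSectorGap Δ (cs * Real.sqrt (f₀ / κ)) k := by
  apply symmetricSectorGap_of_symGapAtLeast
  filter_upwards [h] with L hL
  intro _ j hj
  obtain ⟨hK, hF, hR⟩ := hL j hj
  exact symGapAtLeast_of_saturationSym hκ hcs (singleMode_of_densityResponse hK) hF hR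

end Summit.HubbardSuperconductivity.HubbardSuperconductivity.Theorems.AnisotropyChord.Transfer
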